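import Summits.BirchSwinnertonDyer.BirchSwinnertonDyer.Theses.GenusKolyvaginAtTwo

/-!
# Route `GenusKolyvaginAtTwo`, crux #3 `KolyvaginExactAtTwo` (stmt-BirchSwinnertonDyer-22137):
# the reciprocity behind «DEF(E,K) is odd» (memo ANALYSIS-22137 v5.2 §12) — helper, PROVED
# (seat `bsd-line-gk2-p2`, gen 4)

For a Heegner pair `(E, K)` with `d_K = −d` odd (so `d ≡ 3 (mod 4)`) every prime of the conductor
splits in `K`, and the minimal discriminant `Δ` has the same prime support as the conductor (plus
`2 ∣ Δ ⟹ 2 ∣ N ⟹ 2` split `⟹ d ≡ 7 (mod 8)`). Quadratic reciprocity then gives `J(|Δ| ∣ d) = 1` and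
hence `J(Δ ∣ d) = −1` or `+1` according as `Δ < 0` or `Δ > 0`. Since `J(Δ ∣ d) = ∏_{q ∣ d} (Δ/q)` and
`(Δ/q) = −1` exactly when `Frob_q` is a transposition on `E[2]` (odd permutation: `q` inert in
`ℚ(√Δ) ⊂ ℚ(E[2])`), i.e. when `dim Ẽ(𝔽_q)[2] = 1`, this is the parity statement
`(−1)^{Σ_q e_q} = sign Δ`, whence `DEF(E,K) = Σ_{q ∣ d_K} e_q + [Δ > 0]` is ODD (memo §12; tested on
37a/43a, §13). This file proves the reciprocity core as pure arithmetic on Jacobi symbols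
(Mathlib `jacobiSym`); the dictionary `e_q ↔ (Δ/q)` (number of roots of the 2-division cubic vs.
its discriminant) is not restated here. Helper for the crux item (`--supports`); BSD is not proved
by any of this.
-/

set_option linter.dupNamespace false

namespace Summit.BirchSwinnertonDyer.BirchSwinnertonDyer.Theorems.GenusExact

open scoped NumberTheorySymbols

/-- **An odd prime splitting in `ℚ(√−d)` is a square modulo `d`** (`d ≡ 3 (mod 4)`): if
`J(−d ∣ p) = 1` then `J(p ∣ d) = 1`. Reciprocity: for `p ≡ 1 (mod 4)`, `J(p ∣ d) = J(d ∣ p) = J(−d ∣ p)`;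
for `p ≡ 3 (mod 4)`, `J(p ∣ d) = −J(d ∣ p) = J(−d ∣ p)`. [folklore] -/
theorem jacobiSym_prime_eq_one_of_split {d p : ℕ} (hd : d % 4 = 3) (hp : p.Prime) (hp2 : p ≠ 2)
    (hsplit : J(-(d : ℤ) | p) = 1) : J((p : ℤ) | d) = 1 := by
  have hpodd : Odd p := hp.odd_of_ne_two hp2
  have hdodd : Odd d := by rw [Nat.odd_iff]; omega
  rw [jacobiSym.neg _ hpodd] at hsplit
  rcases Nat.odd_mod_four_iff.mp (Nat.odd_iff.mp hpodd) with h1 | h3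
  · rw [ZMod.χ₄_nat_one_mod_four h1, one_mul] at hsplit
    rw [jacobiSym.quadratic_reciprocity_one_mod_four h1 hdodd]
    exact hsplit
  · rw [ZMod.χ₄_nat_three_mod_four h3, neg_one_mul] at hsplit
    rw [jacobiSym.quadratic_reciprocity_three_mod_four h3 hd, ← hsplit]

/-- **`J(m ∣ d) = 1` when every prime of `m` splits in `ℚ(√−d)`** (`d ≡ 3 (mod 4)`; at `2`:
`d ≡ 7 (mod 8)`). By multiplicativity over the prime factorisation of `m`. Applied to `m = |Δ_E|`,
whose primes are those of the conductor, all split in the Heegner field. [folklore] -/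
theorem jacobiSym_eq_one_of_forall_prime_split {d : ℕ} (hd : d % 4 = 3) :
    ∀ m : ℕ, m ≠ 0 → (∀ p : ℕ, p.Prime → p ∣ m → p ≠ 2 → J(-(d : ℤ) | p) = 1) →
      (2 ∣ m → d % 8 = 7) → J((m : ℤ) | d) = 1 := by
  have hdodd : Odd d := by rw [Nat.odd_iff]; omega
  intro m
  induction m using induction_on_primes with
  | zero => intro h; exact absurd rfl h
  | one => intros; exact jacobiSym.one_left d
  | prime_mul p a hp ih =>
    intro hpa hsplit h2
    have ha0 : a ≠ 0 := right_ne_zero_of_mul hpa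
    rw [Nat.cast_mul, jacobiSym.mul_left]
    have hJa : J((a : ℤ) | d) = 1 :=
      ih ha0 (fun q hq hqa hq2 ↦ hsplit q hq (Dvd.dvd.mul_left hqa p) hq2)
        (fun h2a ↦ h2 (Dvd.dvd.mul_left h2a p))
    have hJp : J((p : ℤ) | d) = 1 := by
      by_cases hp2 : p = 2
      · subst hp2
        have h8 : d % 8 = 7 := h2 (Dvd.intro a rfl)
        rw [Nat.cast_ofNat, jacobiSym.at_two hdodd, ZMod.χ₈_nat_eq_if_mod_eight]
        have hne : d % 2 ≠ 0 := by omega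
        simp [hne, h8]
      · exact jacobiSym_prime_eq_one_of_split hd hp hp2 (hsplit p hp (Dvd.intro a rfl) hp2)
    rw [hJp, hJa, one_mul]

/-- **The sign of `J(Δ ∣ d)`**: under the same splitting hypotheses on the primes of `|Δ|`,
`J(Δ ∣ d) = 1` if `Δ > 0` and `J(Δ ∣ d) = −1` if `Δ < 0` (`J(−1 ∣ d) = χ₄(d) = −1` for
`d ≡ 3 (mod 4)`). With `J(Δ ∣ d) = ∏_{q ∣ d} (Δ/q) = (−1)^{#transposition primes of d}` this is
«`DEF(E,K)` is odd» (memo v5.2 §12). [folklore] -/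
theorem jacobiSym_eq_neg_one_pow_of_forall_prime_split {d : ℕ} (hd : d % 4 = 3) {Δ : ℤ}
    (hΔ : Δ ≠ 0) (hsplit : ∀ p : ℕ, p.Prime → (p : ℤ) ∣ Δ → p ≠ 2 → J(-(d : ℤ) | p) = 1)
    (h2 : (2 : ℤ) ∣ Δ → d % 8 = 7) :
    J(Δ | d) = if Δ < 0 then -1 else 1 := by
  have hdodd : Odd d := by rw [Nat.odd_iff]; omega
  have habs : J((Δ.natAbs : ℤ) | d) = 1 :=
    jacobiSym_eq_one_of_forall_prime_split hd Δ.natAbs (Int.natAbs_ne_zero.mpr hΔ)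
      (fun p hp hpd hp2 ↦ hsplit p hp (Int.natCast_dvd.mpr hpd) hp2)
      (fun h2d ↦ h2 (Int.natCast_dvd.mpr (by exact_mod_cast h2d)))
  split_ifs with hneg
  · have hΔ' : Δ = -(Δ.natAbs : ℤ) := by omega
    rw [hΔ', jacobiSym.neg _ hdodd, habs, mul_one, ZMod.χ₄_nat_three_mod_four hd]
  · have hΔ' : Δ = (Δ.natAbs : ℤ) := by omega
    rw [hΔ', habs]

end Summit.BirchSwinnertonDyer.BirchSwinnertonDyer.Theorems.GenusExact
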